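import Summits.ResolutionOfSingularities.ResolutionOfSingularities.Theorems.EquisingularLiftEquisingularLiftNatDirStepUnobsTransport
import Summits.ResolutionOfSingularities.ResolutionOfSingularities.Theorems.EquisingularLiftEquisingularLiftNatSectionRootTransport
import HarnessLib

/-!
# [OURS · L1 W4.5(b) · EL♮(3) · NEST host kit] `DirStepUnobs`: from the host `univ` of a reduced scheme to a proper closed host `E ⊊ G`

Crux chain w45b (cell `res-hironaka`, LADDER-RESOLUTION rung L, slot W4.5(b)), child EL♮(3) = stmt-ResolutionOfSingularities-20148;
WIDTH TABLE D3 «NEST» (desk RULING R39): the NEST round of `TowerNestB₅` (✓ `…NatTowerNestDefs`) carries the residue-side clause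
`DirStepUnobs G' E' hE' Z hZ` whose HOST is the fresh exceptional plane `E' = υ₂⁻¹{y} ⊊ G'` (R39 (i): «certified per specimen»),
while the chart-data PRODUCERS of `DirStepUnobs` (res-L1-w45b-nose-w1 g2, D3-7 `dirStepUnobs_univ_of_charts`; res-L1-w45b-nose-w3 g2,
✓ p654480 `…NatDirStepUnobsOfTwoCharts`) and the MODEL certificates (res-L1-w45b-iso-w4 g2, D3-8: the conic `Γ_q ⊂ ℙ²`) conclude at
the host `Set.univ` of a REDUCED scheme.  This file is the door between the two shapes (res-L1-w45b-crit-2's HOST-SHAPE note,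
STATUS 2026-08-28T17:56:28Z).  res-L1-w45b-iso-w2 g2 (WIDTH seat D-0157 DOOR 1), `--supports stmt-ResolutionOfSingularities-20148
--as helper`.  OURS; NOT a statement of any manuscript; AI-written, weaker than expert review.  No `sorry`; standard axioms; DEF-FREE.

WHAT (namespace `…Cruxes.EquisingularLiftNat.Sections`).
* `dirStepUnobs_congr_set` — `DirStepUnobs G E hE Z hZ` only depends on the SET `Z` (proof-irrelevance bookkeeping).
* `isIso_redSubι_univ_aux` (private) — for a reduced scheme `X`, `redSubι X univ : redSub X univ ⟶ X` is an isomorphism (Mathlib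
  `vanishingIdeal_top`, `nilradical_eq_bot`); `isReduced_redSub` — every `redSub` is reduced (Literature `ComponentGluing`).
* **`dirStepUnobs_of_univ_redSub`** (H1) — for `Z ⊆ E ⊆ G` closed: unobstructedness of `Z` in the host `univ` of the reduced scheme
  `Ẽ = redSub G E hE` (the set `Z` read inside `Ẽ` as `(redSubι G E hE)⁻¹ Z`) gives `DirStepUnobs G E hE Z hZ`.  Proof: B0
  ✓ `dirStepUnobs_transport` (…NatDirStepUnobsTransport) along `ϱ := redSubι G E hE` with `ε := redSubι Ẽ univ` (an isomorphism) and
  `εZ` the uniqueness-of-the-reduced-structure isomorphism ✓ `exists_isIso_redSub_image` (…NatSectionRootTransport).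
* **`dirStepUnobs_of_model_iso`** (H2) — the MODEL door: a certificate `DirStepUnobs P univ _ Γ hΓ` on a reduced model `P` (e.g. `ℙ²_k`
  with `Γ` a conic) and ONE isomorphism `e : P ≅ redSub G E hE` («fresh plane ≅ model») carrying `Γ` onto `Z` give
  `DirStepUnobs G E hE Z hZ` (B0 along `e.hom`, then (H1)).

So a NEST customer has two doors: (i) chart data on two affine opens OF THE FRESH PLANE `Ẽ'` itself, fed to D3-7 at `G := Ẽ'`, then
(H1); (ii) a model certificate (D3-8) plus the specimen isomorphism `ℙ² ≅ Ẽ'`, then (H2).  Degenerate instances (checked by type):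
`Z = ∅` — both hypothesis and conclusion are inhabited (`redSub _ ∅` is empty, every `CechMH1` on it a subsingleton); `E = univ` with
`G` reduced — (H1) is transport along the isomorphism `redSub G univ ≅ G`; `e` «identity-like» (`P := redSub G E hE`, `e := Iso.refl`)
— (H2) IS (H1).  HONEST SCOPE: plumbing only — no cohomology is computed here; counted 0; EL♮(3) is NOT proved; resolution in
characteristic `p` is NOT proved here (dim 3 is Cossart–Piltant 2008/2009 in print).

References (index only): R. Hartshorne, *Algebraic Geometry* (1977), II Example 3.2.6 (reduced induced structure), III §4
[cite: Hartshorne1977]; The Stacks Project, Tag 01J3 [cite: StacksProject].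
-/

set_option linter.dupNamespace false -- mandated namespace `Summit.<Summit>.<Problem>` of this single-conjunct summit

noncomputable section

open CategoryTheory AlgebraicGeometry TopologicalSpace
open AlgebraicGeometry.Scheme.IdealSheafData

namespace Summit.ResolutionOfSingularities.ResolutionOfSingularities.Cruxes.EquisingularLiftNat.Sections

/-! ### Bookkeeping -/

/-- `DirStepUnobs G E hE Z hZ` depends on the closed SET `Z` only (the closedness proof is irrelevant). [OURS · bookkeeping] -/
theorem dirStepUnobs_congr_set {G : Scheme.{0}} {E : Set G} {hE : IsClosed E} {Z Z' : Set G} {hZ : IsClosed Z}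
    {hZ' : IsClosed Z'} (h : Z = Z') : DirStepUnobs G E hE Z hZ ↔ DirStepUnobs G E hE Z' hZ' := by
  subst h
  exact Iff.rfl

/-- Every reduced closed subscheme `redSub G E hE` is reduced. [folklore] -/
theorem isReduced_redSub (G : Scheme.{0}) (E : Set G) (hE : IsClosed E) : IsReduced (redSub G E hE) :=
  Literature.AlgebraicGeometry.Resolution.ComponentGluing.isReduced_subscheme_vanishingIdeal _

/-- For a REDUCED scheme `X`, the reduced closed subscheme on the whole space is all of `X`: `redSubι X univ` is an isomorphism
(`𝓘⟨univ⟩ = nil(X) = 0`).  (Private twin of `…Sections.isIso_redSubι_univ` of ✓ `…NatUnobsNoseFirstRung`, re-proved here in three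
lines to keep this kit's imports free of the nose rung.) [folklore] -/
private theorem isIso_redSubι_univ_aux (X : Scheme.{0}) [IsReduced X] : IsIso (redSubι X Set.univ isClosed_univ) := by
  have htop : (⟨Set.univ, isClosed_univ⟩ : Closeds X) = ⊤ := Closeds.ext rfl
  change IsIso (vanishingIdeal (⟨Set.univ, isClosed_univ⟩ : Closeds X)).subschemeι
  rw [Scheme.isIso_subschemeι_iff_eq_bot, htop, vanishingIdeal_top, Scheme.nilradical_eq_bot]

/-- The points of `redSub G E hE` map into `E`, and `redSubι ⁻¹ Z` maps ONTO `Z` when `Z ⊆ E`. [folklore] -/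
theorem image_preimage_redSubι_eq {G : Scheme.{0}} {E : Set G} (hE : IsClosed E) {Z : Set G} (hZE : Z ⊆ E) :
    (redSubι G E hE : redSub G E hE → G) '' ((redSubι G E hE : redSub G E hE → G) ⁻¹' Z) = Z := by
  rw [Set.image_preimage_eq_inter_range]
  refine Set.inter_eq_left.mpr fun x hx => ?_
  rw [range_subschemeι, coe_support_vanishingIdeal]
  exact hZE hx

/-! ### (H1) From the host `univ` of `Ẽ` to the host `E` of `G` -/

/-- **(H1) — NEST HOST CHANGE.**  Let `Z ⊆ E ⊆ G` be closed subsets and `Ẽ = redSub G E hE` the reduced closed subscheme on `E`.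
If `Z`, read inside `Ẽ` (as `redSubι⁻¹ Z`), has unobstructed embedded deformations in the host `univ` of `Ẽ`
(`DirStepUnobs Ẽ univ _ (redSubι⁻¹ Z) _` — the shape produced by the chart-data producers at `G := Ẽ`), then
`DirStepUnobs G E hE Z hZ` (the shape of the NEST round's clause, host = the fresh plane `E ⊊ G`).  Transport (B0) along
`ϱ := redSubι G E hE : Ẽ ⟶ G` with `ε := redSubι Ẽ univ` (an isomorphism, `Ẽ` reduced) and the canonical isomorphism of the two reduced
structures on the set `Z`.  On the binder `hZE : Z ⊆ E`: for `Z ⊄ E` the target is VACUOUS (no `i : Z̃ ⟶ Ẽ` over `G` exists, the supports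
being the sets) while `h` only speaks about `Z ∩ E`; `hZE` is what B0 consumes (res-L1-w45b-crit-2, by-type pre-clear 2026-08-28).
[OURS · L1 W4.5b · EL♮(3) · NEST host kit; NOT a statement of the manuscript] -/
theorem dirStepUnobs_of_univ_redSub (G : Scheme.{0}) (E : Set G) (hE : IsClosed E) (Z : Set G) (hZ : IsClosed Z) (hZE : Z ⊆ E)
    (h : DirStepUnobs (redSub G E hE) Set.univ isClosed_univ
      ((redSubι G E hE : redSub G E hE → G) ⁻¹' Z) (hZ.preimage (redSubι G E hE).continuous)) :
    DirStepUnobs G E hE Z hZ := by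
  haveI : IsReduced (redSub G E hE) := isReduced_redSub G E hE
  haveI := isIso_redSubι_univ_aux (redSub G E hE)
  -- the isomorphism `εZ : redSub Ẽ (ϱ⁻¹ Z) ≅ redSub G (ϱ '' ϱ⁻¹ Z)` over `ϱ := redSubι G E hE`
  obtain ⟨hc, εZ, hεZ, hεZiso⟩ := exists_isIso_redSub_image (redSubι G E hE) (E := Set.univ) isClosed_univ hE
    (redSubι (redSub G E hE) Set.univ isClosed_univ) rfl (hZ.preimage (redSubι G E hE).continuous) (Set.subset_univ _)
  have hunobs := dirStepUnobs_transport (redSub G E hE) Set.univ isClosed_univ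
    ((redSubι G E hE : redSub G E hE → G) ⁻¹' Z) (hZ.preimage (redSubι G E hE).continuous)
    G (redSubι G E hE) E hE _ hc (redSubι (redSub G E hE) Set.univ isClosed_univ) εZ (Set.subset_univ _)
    (by rw [image_preimage_redSubι_eq hE hZE]; exact hZE) inferInstance rfl hεZiso hεZ h
  exact (dirStepUnobs_congr_set (image_preimage_redSubι_eq hE hZE)).mp hunobs

/-! ### (H2) The model door -/

/-- The isomorphism `redSub P univ ⟶ redSub Q univ` over an isomorphism `e : P ⟶ Q` of reduced schemes. [folklore] -/
theorem exists_isIso_redSub_univ_over {P Q : Scheme.{0}} [IsReduced P] [IsReduced Q] (e : P ⟶ Q) [IsIso e] :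
    ∃ ε : redSub P Set.univ isClosed_univ ⟶ redSub Q Set.univ isClosed_univ,
      ε ≫ redSubι Q Set.univ isClosed_univ = redSubι P Set.univ isClosed_univ ≫ e ∧ IsIso ε := by
  haveI := isIso_redSubι_univ_aux P
  haveI := isIso_redSubι_univ_aux Q
  refine ⟨redSubι P Set.univ isClosed_univ ≫ e ≫ inv (redSubι Q Set.univ isClosed_univ), ?_, inferInstance⟩
  simp only [Category.assoc, IsIso.inv_hom_id, Category.comp_id]

/-- **(H2) — THE MODEL DOOR.**  A certificate `DirStepUnobs P univ _ Γ hΓ` on a model scheme `P` (e.g. `P = ℙ²_k`, `Γ` a smooth conic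
— the D3-8 shape), an isomorphism `e : P ≅ Ẽ = redSub G E hE` («fresh plane ≅ model»; it forces `P` reduced) and the bookkeeping
`e(Γ) = redSubι⁻¹ Z` for closed `Z ⊆ E ⊆ G` give the NEST clause `DirStepUnobs G E hE Z hZ`.  Transport (B0) along `e.hom`, then (H1).
`he` is load-bearing (it pins the model curve to `Z`); `hZE` as in (H1). [OURS · L1 W4.5b · EL♮(3) · NEST host kit; NOT a statement of the
manuscript] -/
theorem dirStepUnobs_of_model_iso (P : Scheme.{0}) (Γ : Set P) (hΓ : IsClosed Γ)
    (hP : DirStepUnobs P Set.univ isClosed_univ Γ hΓ)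
    (G : Scheme.{0}) (E : Set G) (hE : IsClosed E) (Z : Set G) (hZ : IsClosed Z) (hZE : Z ⊆ E)
    (e : P ≅ redSub G E hE) (he : (e.hom : P → redSub G E hE) '' Γ = (redSubι G E hE : redSub G E hE → G) ⁻¹' Z) :
    DirStepUnobs G E hE Z hZ := by
  haveI : IsReduced (redSub G E hE) := isReduced_redSub G E hE
  haveI : IsReduced P := isReduced_of_isOpenImmersion e.hom
  -- transport along `e.hom : P ⟶ Ẽ` at the host `univ`
  obtain ⟨ε, hε, hεiso⟩ := exists_isIso_redSub_univ_over e.hom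
  haveI := hεiso
  obtain ⟨hc, εZ, hεZ, hεZiso⟩ := exists_isIso_redSub_image e.hom (E := Set.univ) isClosed_univ isClosed_univ ε hε hΓ
    (Set.subset_univ _)
  have h1 : DirStepUnobs (redSub G E hE) Set.univ isClosed_univ ((e.hom : P → redSub G E hE) '' Γ) hc :=
    dirStepUnobs_transport P Set.univ isClosed_univ Γ hΓ (redSub G E hE) e.hom Set.univ isClosed_univ _ hc ε εZ
      (Set.subset_univ _) (Set.subset_univ _) hεiso hε hεZiso hεZ hP
  -- then the host change (H1)
  exact dirStepUnobs_of_univ_redSub G E hE Z hZ hZE ((dirStepUnobs_congr_set he).mp h1)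

end Summit.ResolutionOfSingularities.ResolutionOfSingularities.Cruxes.EquisingularLiftNat.Sections

end
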